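import Summits.Ventures.PercRepro.C041TriDomAnchoredDomination

/-!
# ROW C-041 — COROLLARY (TWO CLASSES): every two of the three cyclic crossed classes are outnumbered by `(⊤,⊥)` on
every up-set of every status (p6, gen 48; P6-TWOEXIT-LEAN.md §53 ADDENDUM 22 cont. 3)

The anchored conjecture with anchor `x` (`ancDominationS_of_S1`) dominates `(s₁,s₂) ∪ (s₂,s₃) ∪ (s₁,s₃)`; dropping
its third class gives the cyclic pair `(s₁,s₂) ∪ (s₂,s₃)` (`pair12_23_le_topBotS`).  The other two cyclic pairs are
the rotations: with anchor `y` the anchored classes `(s₁,s₂)_{yzx} ∪ (s₂,s₃)_{yzx}` are `(s₃,s₁) ∪ (s₁,s₂)` of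
`(x, y, z)` (`c12S_rot`, `c23S_rot`: `pair12_31_le_topBotS`), with anchor `z` they are `(s₂,s₃) ∪ (s₃,s₁)`
(`pair23_31_le_topBotS`).  CONJECTURE (STOCHASTIC DOMINATION) is the statement for all three classes at once.
-/

namespace PercRepro

namespace ZoneZ

namespace MultiExit

open ZoneData Finset

variable {V₁ E₁ U₁ U₂ : Type} (Z₁ : ZoneData V₁ E₁ U₁ U₂) (st : E₁ → EStat) (x y z : V₁)

/-! ## The classes under the rotation of the marks -/

/-- `(s₁,s₂)` of `(y, z, x)` is `(s₃,s₁)` of `(x, y, z)`. -/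
theorem c12S_rot (ω : E₁ → Bool) : C12S Z₁ st y z x ω ↔ C31S Z₁ st x y z ω := by
  unfold C12S C31S
  rw [RdS_comm Z₁ st ω y x, RdS_comm Z₁ st ω z x, MgS_comm Z₁ st ω y x, MgS_comm Z₁ st ω z x]
  tauto

/-- `(s₂,s₃)` of `(y, z, x)` is `(s₁,s₂)` of `(x, y, z)`. -/
theorem c23S_rot (ω : E₁ → Bool) : C23S Z₁ st y z x ω ↔ C12S Z₁ st x y z ω := by
  unfold C23S C12S
  rw [RdS_comm Z₁ st ω y x, RdS_comm Z₁ st ω z x, MgS_comm Z₁ st ω y x, MgS_comm Z₁ st ω z x]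
  tauto

/-- `(s₃,s₁)` of `(y, z, x)` is `(s₂,s₃)` of `(x, y, z)`. -/
theorem c31S_rot (ω : E₁ → Bool) : C31S Z₁ st y z x ω ↔ C23S Z₁ st x y z ω := by
  unfold C31S C23S
  rw [RdS_comm Z₁ st ω y x, RdS_comm Z₁ st ω z x, MgS_comm Z₁ st ω y x, MgS_comm Z₁ st ω z x]
  tauto

/-! ## The three pairs -/

variable [DecidableEq E₁] [Fintype E₁]

open Classical in
/-- The pair `(s₁,s₂) ∪ (s₂,s₃)` is dominated on every up-set of every status. -/
theorem pair12_23_le_topBotS {V : (E₁ → Bool) → Prop} (hV : UpSet V) :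
    (univ.filter fun ω : E₁ → Bool => V ω ∧ (C12S Z₁ st x y z ω ∨ C23S Z₁ st x y z ω)).card ≤
      (univ.filter fun ω : E₁ → Bool => V ω ∧ TopBotS Z₁ x y z st ω).card := by
  refine (Finset.card_le_card fun ω hω => ?_).trans (ancDominationS_of_S1 Z₁ y z x st V hV)
  rw [Finset.mem_filter] at hω ⊢
  refine ⟨hω.1, hω.2.1, ?_⟩
  rw [ancCrossedS_iff_classes]
  rcases hω.2.2 with h | h
  · exact Or.inl h
  · exact Or.inr (Or.inl h)

open Classical in
/-- The pair `(s₁,s₂) ∪ (s₃,s₁)` is dominated on every up-set of every status (the anchored conjecture at `y`). -/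
theorem pair12_31_le_topBotS {V : (E₁ → Bool) → Prop} (hV : UpSet V) :
    (univ.filter fun ω : E₁ → Bool => V ω ∧ (C12S Z₁ st x y z ω ∨ C31S Z₁ st x y z ω)).card ≤
      (univ.filter fun ω : E₁ → Bool => V ω ∧ TopBotS Z₁ x y z st ω).card := by
  have h := ancDominationS_of_S1 Z₁ z x y st V hV
  refine (Finset.card_le_card fun ω hω => ?_).trans (h.trans_eq (card_filter_congr' fun ω _ =>
    and_congr_right fun _ => (topBotS_rot Z₁ st x y z ω).symm))
  rw [Finset.mem_filter] at hω ⊢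
  refine ⟨hω.1, hω.2.1, ?_⟩
  rw [ancCrossedS_iff_classes]
  rcases hω.2.2 with h | h
  · exact Or.inr (Or.inl ((c23S_rot Z₁ st x y z ω).mpr h))
  · exact Or.inl ((c12S_rot Z₁ st x y z ω).mpr h)

open Classical in
/-- The pair `(s₂,s₃) ∪ (s₃,s₁)` is dominated on every up-set of every status (the anchored conjecture at `z`). -/
theorem pair23_31_le_topBotS {V : (E₁ → Bool) → Prop} (hV : UpSet V) :
    (univ.filter fun ω : E₁ → Bool => V ω ∧ (C23S Z₁ st x y z ω ∨ C31S Z₁ st x y z ω)).card ≤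
      (univ.filter fun ω : E₁ → Bool => V ω ∧ TopBotS Z₁ x y z st ω).card := by
  have h := ancDominationS_of_S1 Z₁ x y z st V hV
  have hrot : ∀ ω : E₁ → Bool, TopBotS Z₁ z x y st ω ↔ TopBotS Z₁ x y z st ω := fun ω =>
    topBotS_rot Z₁ st z x y ω
  refine (Finset.card_le_card fun ω hω => ?_).trans (h.trans_eq (card_filter_congr' fun ω _ =>
    and_congr_right fun _ => hrot ω))
  rw [Finset.mem_filter] at hω ⊢
  refine ⟨hω.1, hω.2.1, ?_⟩
  rw [ancCrossedS_iff_classes]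
  rcases hω.2.2 with h | h
  · exact Or.inl ((c12S_rot Z₁ st y z x ω).mpr ((c31S_rot Z₁ st x y z ω).mpr h))
  · exact Or.inr (Or.inl ((c23S_rot Z₁ st y z x ω).mpr ((c12S_rot Z₁ st x y z ω).mpr h)))

end MultiExit

end ZoneZ

end PercRepro
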